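import Summits.ResolutionOfSingularities.ResolutionOfSingularities.Theorems.WeightedInvariantWeightedThesisTowerGenericAmbient
import Summits.ResolutionOfSingularities.ResolutionOfSingularities.Theorems.WeightedInvariantDatumToEmbedded
import HarnessLib

/-!
# The cobordant tower for an arbitrary regular weighted centre — Veronese degree, atlas, quotient step

Support for crux `stmt-ResolutionOfSingularities-0569`
(`Summit.ResolutionOfSingularities.ResolutionOfSingularities.Theses.WeightedInvariant.WeightedThesis`),
line `datum-glued-split`, RESHAPE 7 (lead c7); companion of
`Theorems/WeightedInvariantWeightedThesisTowerGenericAmbient.lean`. The remaining step lemmas of the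
tower of crux `DatumToEmbedded` (stmt-0572) — the choice of the Veronese degree
(`Degree.stub_qs_degree`), the graded atlas of rank `j + 1` on the blow-up downstairs
(`Atlas.gradedAtlas_succ`, with `AtlasAmbient.stub_qs_atlas_ambient` and
`AtlasQuotient.stub_qs_atlasQuotientOf` inlined through their datum-free cores
`AtlasAmbient.exists_ambientChart`, `AtlasQuotient.preimage_W'_eq`,
`AtlasQuotient.app_blowupChart_injective`) and the quotient step (`DatumToEmbedded.quotientStep`) —
restated for an ARBITRARY regular weighted centre `R` on `Y` whose support misses the generic point of
the integral `X`, with a Rees filtration `R'` carrying the pieces of `R` (proofs verbatim, the datum's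
axioms `(ii)`/`(iii)` replaced by the hypotheses `hc : R.IsRegularWeightedCentre`,
`hξ : i (genericPoint X) ∉ R.support`):

* `Degree.exists_veronese_chart_of_isRegularWeightedCentre`, `Degree.qs_degree_of_isRegularWeightedCentre`;
* `Atlas.gradedAtlas_succ_of_isRegularWeightedCentre`;
* `DatumToEmbedded.quotientStep_of_isRegularWeightedCentre` (registered stub).

Setting and notation as in the source files (Włodarczyk, arXiv:2203.03090, §2.3.3: the torus quotient
of the cobordant blow-up is the blow-up of the quotient downstairs).
-/

noncomputable section

open CategoryTheory CategoryTheory.Limits AlgebraicGeometry TopologicalSpace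
open Literature.AlgebraicGeometry.Resolution
open Summit.ResolutionOfSingularities.ResolutionOfSingularities.Theses.WeightedInvariant
open Summit.ResolutionOfSingularities.ResolutionOfSingularities.Theorems

set_option linter.dupNamespace false -- mandated namespace `…Theorems.DatumToEmbedded.<Topic>`
-- `Γ(B₊, W')` versus `presheaf.obj` inside `rw` motives and instance problems on the glued scheme
-- `R'.cobordantBlowup` / `R'.plus` (as in the source files `…Degree`, `…AtlasSucc`):
set_option backward.isDefEq.respectTransparency false

/-! ## The Veronese degree -/

namespace Summit.ResolutionOfSingularities.ResolutionOfSingularities.Theorems.DatumToEmbedded.Degree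

section Chart

variable {k : Type} [Field k]
  {Y X V : Scheme.{0}} (f : Y ⟶ Spec (.of k)) [Smooth f]
  (i : X ⟶ Y) [IsClosedImmersion i] (q : X ⟶ V) {j : ℕ} (𝒜 : GradedAtlas j f i q)
  (R : ReesAlgebraData Y) (hc : R.IsRegularWeightedCentre)
  (hhom : ∀ (a : 𝒜.ι) (n : ℕ), letI := 𝒜.gradedRing a;
    ((R.piece n).ideal (𝒜.W a)).IsHomogeneous (𝒜.piece a))
  (R' : ReesFiltration Y) (hR' : R'.ideal = R.piece)

include hc hhom R' hR' in
/-- **(A2) on one chart of the atlas** (datum-free form of `exists_veronese_chart`): on the `ℤʲ`-graded chart ring `A = Γ(Y, W a)` (of finite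
type over `Γ(Spec k)`, scalars in degree `0`) the pieces `Jₙ(W a)` of the centre are homogeneous
and their extended Rees algebra is of finite type over `A` (`ExtReesRegular.finiteType`, any affine
open of a regular weighted centre), so `…DegreeRees.veronese_degreeZero` gives `dₐ > 0` such that
for all multiples `d'` of `dₐ` the degree-`0` part of `J_{d'(l+1)}(W a)` lies in the additive
closure of the products of degree-`0` elements of `J_{d'}(W a)` and `J_{d'l}(W a)`.
[cite: Wlodarczyk2022, §2.3.3] -/
theorem exists_veronese_chart_of_isRegularWeightedCentre (a : 𝒜.ι) :
    ∃ d : ℕ, 0 < d ∧ ∀ d' : ℕ, d ∣ d' → ∀ (l : ℕ) (x : Γ(Y, 𝒜.W a)),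
      x ∈ (R.piece (d' * (l + 1))).ideal (𝒜.W a) → x ∈ 𝒜.piece a 0 →
      x ∈ AddSubgroup.closure {z : Γ(Y, 𝒜.W a) | ∃ u v : Γ(Y, 𝒜.W a),
        u ∈ (R.piece d').ideal (𝒜.W a) ∧ u ∈ 𝒜.piece a 0 ∧
        v ∈ (R.piece (d' * l)).ideal (𝒜.W a) ∧ v ∈ 𝒜.piece a 0 ∧
        z = u * v} := by
  classical
  letI := 𝒜.gradedRing a
  -- the scalars `Γ(Spec k) → Γ(Y, W a)`, in degree `0`, of finite type
  letI alg : Algebra Γ(Spec (.of k), ⊤) Γ(Y, 𝒜.W a) := (f.appLE ⊤ (𝒜.W a) le_top).hom.toAlgebra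
  have h0 : ∀ c : Γ(Spec (.of k), ⊤), algebraMap Γ(Spec (.of k), ⊤) Γ(Y, 𝒜.W a) c ∈ 𝒜.piece a 0 :=
    𝒜.appLE_mem a
  have hA : Algebra.FiniteType Γ(Spec (.of k), ⊤) Γ(Y, 𝒜.W a) :=
    HasRingHomProperty.appLE @LocallyOfFiniteType f inferInstance ⟨⊤, isAffineOpen_top _⟩ (𝒜.W a)
      le_top
  -- the filtration of the centre on the chart: homogeneous, extended Rees algebra of finite type
  have hF : ∀ n, ((R'.filtration (𝒜.W a)).ideal n).IsHomogeneous (𝒜.piece a) := fun n => by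
    rw [ReesFiltration.filtration_ideal, hR']
    exact hhom a n
  have hR : Algebra.FiniteType Γ(Y, 𝒜.W a) (R'.filtration (𝒜.W a)).extendedRees := by
    change Algebra.FiniteType Γ(Y, 𝒜.W a) (R'.sectionsRing (𝒜.W a))
    rw [WeightedThesis.GlobalCobordantPlus.sectionsRing_eq_extReesAlgebra R R' hR'
      (𝒜.W a)]
    exact ExtReesRegular.finiteType f R hc (𝒜.W a)
  obtain ⟨d, hd, hver⟩ := veronese_degreeZero (𝒜.piece a) h0 hA (R'.filtration (𝒜.W a)) hF hR
  refine ⟨d, hd, fun d' hd' l x hx hx0 => ?_⟩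
  have hx' : x ∈ (R'.filtration (𝒜.W a)).ideal (d' * (l + 1)) := by
    rw [ReesFiltration.filtration_ideal, hR']
    exact hx
  have h := hver d' hd' l x hx' hx0
  simpa only [ReesFiltration.filtration_ideal, hR'] using h

end Chart


/-- **Choice of the Veronese degree** (datum-free form of `stub_qs_degree`, for an arbitrary regular
weighted centre `R`). Given the exceptional identity `J_D · 𝒪_{B₊} = (t⁻¹)^D` for all multiples `D`
of `N₀`, the degree `Dg := e · N₀ · ∏ₐ dₐ` (`e` the exponent of the atlas, `dₐ` the Veronese degrees
of the finitely many charts, `exists_veronese_chart`) is a positive multiple of `N₀` with (A2) on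
every chart the degree-`0` parts of the pieces `J_{Dg·l}(W a)` generated in degree one modulo the
ideal of `X` (even before reducing), and (A3) the downstairs centre
`K = ker (V(J_Dg·𝒪_X) ⟶ X ⟶ V) = q_*(J_Dg·𝒪_X)` pulling back to the `Dg`-th power of the exceptional
ideal on the strict transform: `⊆` because `q^*K ⊆ J_Dg·𝒪_X` and `J_Dg·𝒪_{X'} = (t⁻¹)^{Dg}`
((A1) along `σX ≫ i = ι' ≫ σ₊`), `⊇` by `pow_comap_le_comap_map` from (A1) at `Dg/e`
(Włodarczyk 2022, §2.3.3). [cite: Wlodarczyk2022, §2.3.3] -/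
theorem qs_degree_of_isRegularWeightedCentre :
    ∀ {k : Type} [Field k]
      {Y X V : Scheme.{0}} (f : Y ⟶ Spec (.of k)) [Smooth f] [IsSeparated f] [QuasiCompact f]
      (i : X ⟶ Y) [IsClosedImmersion i] [IsIntegral X] (q : X ⟶ V) [IsIntegral V]
      (g : V ⟶ Spec (.of k)) [IsSeparated g] [LocallyOfFiniteType g] [QuasiCompact g],
      q ≫ g = i ≫ f →
      ∀ {j : ℕ} (𝒜 : GradedAtlas j f i q) (R : ReesAlgebraData Y), R.IsRegularWeightedCentre →
      (∀ (a : 𝒜.ι) (n : ℕ), letI := 𝒜.gradedRing a;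
        ((R.piece n).ideal (𝒜.W a)).IsHomogeneous (𝒜.piece a)) →
      ∀ (R' : ReesFiltration Y), R'.ideal = R.piece →
      ∀ [IsIntegral (R'.strictTransformPlus i.ker).subscheme]
        (σX : (R'.strictTransformPlus i.ker).subscheme ⟶ X),
        σX ≫ i = (R'.strictTransformPlus i.ker).subschemeι ≫ R'.πPlus →
      ∀ (N₀ : ℕ), 0 < N₀ → (∀ Dg : ℕ, N₀ ∣ Dg →
        (R.piece Dg).comap R'.πPlus = R'.excPlus ^ Dg) →
      ∃ Dg : ℕ, 0 < Dg ∧ N₀ ∣ Dg ∧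
        (∀ (a : 𝒜.ι) (l : ℕ) (x : Γ(Y, 𝒜.W a)),
          x ∈ (R.piece (Dg * (l + 1))).ideal (𝒜.W a) → x ∈ 𝒜.piece a 0 →
          ∃ y ∈ AddSubgroup.closure
            {z : Γ(Y, 𝒜.W a) | ∃ u v : Γ(Y, 𝒜.W a),
              u ∈ (R.piece Dg).ideal (𝒜.W a) ∧ u ∈ 𝒜.piece a 0 ∧
              v ∈ (R.piece (Dg * l)).ideal (𝒜.W a) ∧ v ∈ 𝒜.piece a 0 ∧
              z = u * v},
            x - y ∈ i.ker.ideal (𝒜.W a)) ∧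
        ((((R.piece Dg).comap i).subschemeι ≫ q).ker).comap (σX ≫ q) =
          (R'.excPlus.comap (R'.strictTransformPlus i.ker).subschemeι) ^ Dg := by
  intro k _ Y X V f _ _ _ i _ _ q _ g _ _ _ hq j 𝒜 R hc hhom R' hR' _ σX hσX N₀ hN₀ hexc
  classical
  -- `q` is quasi-compact (it is `i ≫ f` followed by nothing worse than the separated `g`)
  haveI : QuasiCompact q := by
    haveI : QuasiCompact (q ≫ g) := by rw [hq]; infer_instance
    exact .of_comp q g
  haveI : IsLocallyNoetherian Y := LocallyOfFiniteType.isLocallyNoetherian f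
  haveI : Finite 𝒜.ι := 𝒜.finite_ι
  letI : Fintype 𝒜.ι := Fintype.ofFinite 𝒜.ι
  -- the Veronese degrees of the finitely many charts
  choose d hd hver using exists_veronese_chart_of_isRegularWeightedCentre f i q 𝒜 R hc hhom R' hR'
  have hD'pos : 0 < N₀ * ∏ a, d a := Nat.mul_pos hN₀ (Finset.prod_pos fun a _ => hd a)
  refine ⟨𝒜.exponent * (N₀ * ∏ a, d a), Nat.mul_pos 𝒜.exponent_pos hD'pos,
    dvd_mul_of_dvd_right (dvd_mul_right N₀ _) _, ?_, ?_⟩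
  · -- (A2): `y := x` itself lies in the closure of the products, already in `Γ(Y, W a)`
    intro a l x hx hx0
    refine ⟨x, hver a _ (dvd_mul_of_dvd_right (dvd_mul_of_dvd_right
      (Finset.dvd_prod_of_mem d (Finset.mem_univ a)) N₀) _) l x hx hx0, ?_⟩
    rw [sub_self]
    exact Ideal.zero_mem _
  · -- (A3)
    -- the exceptional ideal on `X'` is `τ^*(x)` for the coordinate `τ = t⁻¹ : X' ⟶ B₊ ⟶ B ⟶ 𝔸¹`
    have hEeq : R'.excPlus.comap (R'.strictTransformPlus i.ker).subschemeι =
        (affineBlowup.idealSheaf (Ideal.span {Polynomial.X})).comap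
          ((R'.strictTransformPlus i.ker).subschemeι ≫ R'.plus.ι ≫ R'.toA1) := by
      rw [Scheme.IdealSheafData.comap_comp, Scheme.IdealSheafData.comap_comp]
      rfl
    -- (A1) pulled back to `X'` along `σX ≫ i = ι' ≫ σ₊`
    have hE : ∀ n : ℕ, N₀ ∣ n →
        ((affineBlowup.idealSheaf (Ideal.span {Polynomial.X})).comap
          ((R'.strictTransformPlus i.ker).subschemeι ≫ R'.plus.ι ≫ R'.toA1)) ^ n =
        (R.piece n).comap (σX ≫ i) := by
      intro n hn
      rw [← hEeq, ← comap_pow, ← hexc n hn, ← Scheme.IdealSheafData.comap_comp, ← hσX]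
    change (((R.piece (𝒜.exponent * (N₀ * ∏ a, d a))).comap i).map q).comap
      (σX ≫ q) = _
    apply le_antisymm
    · -- `⊆`: `q^* K ⊆ J_Dg · 𝒪_X`, and `J_Dg · 𝒪_{X'} = (t⁻¹)^{Dg}`
      rw [Scheme.IdealSheafData.comap_comp, hEeq,
        hE _ (dvd_mul_of_dvd_right (dvd_mul_right N₀ _) _), Scheme.IdealSheafData.comap_comp]
      exact Scheme.IdealSheafData.comap_mono σX (Scheme.IdealSheafData.comap_map_le _ _)
    · -- `⊇`: the heart
      rw [hEeq]
      exact pow_comap_le_comap_map f i q 𝒜 R.piece hhom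
        (fun n e => piece_pow_le _ n e) σX _ (N₀ * ∏ a, d a) (hE _ (dvd_mul_right N₀ _))

end Summit.ResolutionOfSingularities.ResolutionOfSingularities.Theorems.DatumToEmbedded.Degree

/-! ## The graded atlas of rank `j + 1` -/

namespace Summit.ResolutionOfSingularities.ResolutionOfSingularities.Theorems.DatumToEmbedded.Atlas

/-- **The graded atlas of rank `j + 1` on the blow-up of the quotient**, datum-free form of
`gradedAtlas_succ` for an arbitrary regular weighted centre `R` whose support misses the generic point
of `X` ( Włodarczyk §2.3.3 "the quotient of the
cobordant blow-up is the blow-up downstairs", in the graded encoding): with the notation of the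
module docstring, `q' : X' ⟶ V'` carries a `GradedAtlas (j + 1) (π₊ ≫ f) i' q'`.
[cite: Wlodarczyk2022, §2.3.3] -/
theorem gradedAtlas_succ_of_isRegularWeightedCentre :
    ∀ {k : Type} [Field k]
      {Y X V : Scheme.{0}} (f : Y ⟶ Spec (.of k)) [Smooth f] [IsSeparated f] [QuasiCompact f]
      (i : X ⟶ Y) [IsClosedImmersion i] [IsIntegral X] (q : X ⟶ V) [IsIntegral V]
      (g : V ⟶ Spec (.of k)) [IsSeparated g] [LocallyOfFiniteType g] [QuasiCompact g],
      q ≫ g = i ≫ f →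
      ∀ {j : ℕ} (𝒜 : GradedAtlas j f i q) (R : ReesAlgebraData Y), R.IsRegularWeightedCentre →
      i (genericPoint X) ∉ R.support →
      (∀ (a : 𝒜.ι) (n : ℕ), @Ideal.IsHomogeneous (Fin j → ℤ) (AddSubgroup Γ(Y, 𝒜.W a))
        Γ(Y, 𝒜.W a) _ _ _ (𝒜.piece a) _ _ (𝒜.gradedRing a)
        ((R.piece n).ideal (𝒜.W a))) →
      ∀ (R' : ReesFiltration Y), R'.ideal = R.piece →
      ∀ [Smooth (R'.πPlus ≫ f)] [IsSeparated (R'.πPlus ≫ f)] [QuasiCompact (R'.πPlus ≫ f)]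
        [IsIntegral (R'.strictTransformPlus i.ker).subscheme]
        (σX : (R'.strictTransformPlus i.ker).subscheme ⟶ X),
        σX ≫ i = (R'.strictTransformPlus i.ker).subschemeι ≫ R'.πPlus →
      ∀ (Dg : ℕ), 0 < Dg →
      (R.piece Dg).comap R'.πPlus = R'.excPlus ^ Dg →
      (∀ (a : 𝒜.ι) (l : ℕ) (x : Γ(Y, 𝒜.W a)),
          x ∈ (R.piece (Dg * (l + 1))).ideal (𝒜.W a) → x ∈ 𝒜.piece a 0 →
          ∃ y ∈ AddSubgroup.closure
            {z : Γ(Y, 𝒜.W a) | ∃ u v : Γ(Y, 𝒜.W a),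
              u ∈ (R.piece Dg).ideal (𝒜.W a) ∧ u ∈ 𝒜.piece a 0 ∧
              v ∈ (R.piece (Dg * l)).ideal (𝒜.W a) ∧ v ∈ 𝒜.piece a 0 ∧
              z = u * v},
            x - y ∈ i.ker.ideal (𝒜.W a)) →
      ((((R.piece Dg).comap i).subschemeι ≫ q).ker).comap (σX ≫ q) =
          (R'.excPlus.comap (R'.strictTransformPlus i.ker).subschemeι) ^ Dg →
      ∀ (V' : Scheme.{0}) (ρ : V' ⟶ V),
        IsBlowup ρ (((R.piece Dg).comap i).subschemeι ≫ q).ker →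
        ∀ [IsIntegral V'] (q' : (R'.strictTransformPlus i.ker).subscheme ⟶ V'),
          q' ≫ ρ = σX ≫ q →
          Nonempty (GradedAtlas (j + 1) (R'.πPlus ≫ f)
            (R'.strictTransformPlus i.ker).subschemeι q') := by
  intro k _ Y X V f _ _ _ i _ _ q _ g _ _ _ hq j 𝒜 R hc hξ hhom R' hR' _ _ _ _ σX hσX
    Dg hDg hexc hA2 hA3 V' ρ hρ _ q' hq'
  -- `Y` and `B` are locally Noetherian (the centre is a regular weighted centre)
  haveI : IsLocallyNoetherian Y := LocallyOfFiniteType.isLocallyNoetherian f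
  haveI : LocallyOfFiniteType R'.π :=
    WeightedThesis.GlobalCobordantPlus.locallyOfFiniteType_π R R' hR' hc
  haveI : IsLocallyNoetherian R'.cobordantBlowup := LocallyOfFiniteType.isLocallyNoetherian R'.π
  -- `q` is quasi-compact (it is so after composition with the separated `g`)
  haveI : QuasiCompact q := by
    haveI : QuasiCompact (q ≫ g) := by rw [hq]; infer_instance
    exact .of_comp q g
  -- `V` is locally Noetherian (of finite type over the field `k`)
  haveI : IsLocallyNoetherian V := LocallyOfFiniteType.isLocallyNoetherian g
  -- `t⁻¹` is not identically zero on the integral strict transform `X'`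
  have hτ := Lift.nonempty_preimage_basicOpen_of_not_mem_support i R hc R' hR' hξ
  -- (0) finitely many generators of the downstairs centre `K(U a)` on every chart
  choose s hs using fun a : 𝒜.ι =>
    exists_finset_span_eq ((((R.piece Dg).comap i).subschemeι ≫ q).ker) (𝒜.U a)
  have hbK : ∀ ab : (Σ a : 𝒜.ι, ↥(s a)), (ab.2 : Γ(V, 𝒜.U ab.1)) ∈
      ((((R.piece Dg).comap i).subschemeι ≫ q).ker).ideal (𝒜.U ab.1) :=
    fun ab => (hs ab.1).le (Ideal.subset_span (Finset.mem_coe.mpr ab.2.2))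
  -- (1) degree-zero lifts `β` of the generators, the ambient charts, the quotient charts
  have hβex : ∀ ab : (Σ a : 𝒜.ι, ↥(s a)), ∃ β : Γ(Y, 𝒜.W ab.1),
      β ∈ (R.piece Dg).ideal (𝒜.W ab.1) ∧ β ∈ 𝒜.piece ab.1 0 ∧
        i.app (𝒜.W ab.1) β = q.appLE (𝒜.U ab.1) (i ⁻¹ᵁ (𝒜.W ab.1)) (𝒜.preimage_eq ab.1).le
          (ab.2 : Γ(V, 𝒜.U ab.1)) :=
    fun ab => exists_degreeZero_lift 𝒜 R.piece Dg ab.1 (hhom ab.1 Dg) (hbK ab)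
  choose β hβJ hβ0 hβ using hβex
  choose 𝒞 h𝒞 using fun ab : (Σ a : 𝒜.ι, ↥(s a)) =>
    AtlasAmbient.exists_ambientChart f i q 𝒜 R' hR' ab.1 (hhom ab.1) hDg (hβJ ab) (hβ0 ab)
  -- the quotient charts under the ambient charts (Q1)–(Q4)
  have hQ1 := fun ab : (Σ a : 𝒜.ι, ↥(s a)) =>
    AtlasQuotient.preimage_W'_eq f i q 𝒜 R.piece R' σX hσX Dg _ ρ q' hq' ab.1 hτ hA3 hρ hexc
      (hbK ab) (hβJ ab) (hβ ab) (𝒞 ab)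
  have hQ := fun ab : (Σ a : 𝒜.ι, ↥(s a)) =>
    And.intro (hQ1 ab) (And.intro (AtlasQuotient.appLE_blowupChart_mem_nonZeroDivisors hρ (hbK ab))
      (And.intro (fun c' => AtlasQuotient.exists_of_section_blowupChart hρ (hbK ab) c')
        (And.intro (fun (l : ℕ) (c : Γ(V, 𝒜.U ab.1))
            (hc' : c ∈ ((((R.piece Dg).comap i).subschemeι ≫ q).ker.ideal (𝒜.U ab.1)) ^ l) =>
            AtlasQuotient.exists_section_blowupChart hρ (hbK ab) hc')
          (AtlasQuotient.app_blowupChart_injective f i q 𝒜 _ R' σX hσX Dg _ ρ hρ q' hq' ab.1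
            (hbK ab) (hβ ab) (𝒞 ab) (h𝒞 ab) (hQ1 ab)))))
  -- (2)-(5) the atlas
  refine ⟨{
    ι := Σ a : 𝒜.ι, ↥(s a)
    finite_ι := by haveI := 𝒜.finite_ι; infer_instance
    U := fun ab => ⟨blowupChart ρ ((((R.piece Dg).comap i).subschemeι ≫ q).ker)
      (𝒜.U ab.1) (ab.2 : Γ(V, 𝒜.U ab.1)), hρ.isAffineOpen_blowupChart (hbK ab)⟩
    iSup_eq_top := stub_qs_atlasCover hρ 𝒜.U 𝒜.iSup_eq_top s hs
    W := fun ab => (𝒞 ab).W'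
    preimage_eq := fun ab => (hQ ab).1
    piece := fun ab => (𝒞 ab).piece
    gradedRing := fun ab => (𝒞 ab).gradedRing
    appLE_mem := fun ab c => (𝒞 ab).const_mem c
    isHomogeneous_ker := fun ab => isHomogeneous_ker_chart (𝒞 ab)
    exists_preimage := fun ab s' hs' =>
      exists_preimage_chart 𝒜 R.piece Dg hσX hτ hq' ab.1 (hβ ab) (𝒞 ab)
        (blowupChart_le_preimage ρ _ (𝒜.U ab.1) _) (hQ ab).1 (hA2 ab.1) (hQ ab).2.2.2.1 s' hs'
    exists_lift := fun ab c' =>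
      exists_lift_chart 𝒜 R.piece Dg hσX hτ hq' ab.1 (hβ ab) (𝒞 ab)
        (blowupChart_le_preimage ρ _ (𝒜.U ab.1) _) (hQ ab).1 R.piece_zero
        R.piece_mul_le (hhom ab.1 Dg) (hQ ab).2.2.1 c'
    appLE_injective := fun ab => appLE_injective_of_eq _ (hQ ab).1 (hQ ab).2.2.2.2
    exponent := 𝒜.exponent * Dg
    exponent_pos := Nat.mul_pos 𝒜.exponent_pos hDg
    exists_unit := ?_ }⟩
  · -- homogeneous units of all degrees in `(e Dg)·ℤʲ⁺¹` near every point of `X'`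
    intro x'
    obtain ⟨a, hxa, hunits⟩ := 𝒜.exists_unit (σX x')
    have hqx : ρ (q' x') ∈ (𝒜.U a : V.Opens) := by
      have e1 : (q' ≫ ρ) x' = ρ (q' x') := Scheme.Hom.comp_apply _ _ _
      rw [← e1, hq', Scheme.Hom.comp_apply]
      change σX x' ∈ q ⁻¹ᵁ (𝒜.U a : V.Opens)
      rw [← 𝒜.preimage_eq a]
      exact hxa
    obtain ⟨b, hb⟩ := exists_mem_blowupChart hρ (𝒜.U a) (s a) (hs a) hqx
    refine ⟨⟨a, b⟩, ?_, fun χ' => exists_unit_chart hσX (𝒞 ⟨a, b⟩) 𝒜.exponent hunits χ'⟩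
    have h : x' ∈ q' ⁻¹ᵁ blowupChart ρ _ (𝒜.U a) (b : Γ(V, 𝒜.U a)) := hb
    rw [← (hQ ⟨a, b⟩).1] at h
    exact h


end Summit.ResolutionOfSingularities.ResolutionOfSingularities.Theorems.DatumToEmbedded.Atlas

/-! ## The quotient step -/

namespace Summit.ResolutionOfSingularities.ResolutionOfSingularities.Theorems.DatumToEmbedded

/-- **The quotient of the cobordant blow-up is a blow-up downstairs** (datum-free form of
`quotientStep` for an arbitrary regular weighted centre; registered stub of line `datum-glued-split`,
RESHAPE 7): there is an ideal sheaf
`K ≠ ⊥` on `V` such that for every blow-up `ρ : V' ⟶ V` along `K` the strict transform maps to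
`V'` over `X ⟶ V` with a graded atlas of rank `j + 1` (Veronese degree from
`Exceptional.stub_qs_exceptional` and `Degree.stub_qs_degree_explicit`, the lift from
`Lift.stub_qs_lift`, the atlas from `Atlas.gradedAtlas_succ`).
[cite: Wlodarczyk2022, §2.3.3 and Thm 1.1.4 (5)] -/
theorem quotientStep_of_isRegularWeightedCentre
    {k : Type} [Field k]
    {Y X V : Scheme.{0}} (f : Y ⟶ Spec (.of k)) [Smooth f] [IsSeparated f] [QuasiCompact f]
    (i : X ⟶ Y) [IsClosedImmersion i] [IsIntegral X] (q : X ⟶ V) [IsIntegral V]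
    (g : V ⟶ Spec (.of k)) [IsSeparated g] [LocallyOfFiniteType g] [QuasiCompact g]
    (hq : q ≫ g = i ≫ f) {j : ℕ} (𝒜 : GradedAtlas j f i q)
    (R : ReesAlgebraData Y) (hc : R.IsRegularWeightedCentre) (hξ : i (genericPoint X) ∉ R.support)
    (hhom : ∀ (a : 𝒜.ι) (n : ℕ), @Ideal.IsHomogeneous (Fin j → ℤ) (AddSubgroup Γ(Y, 𝒜.W a))
      Γ(Y, 𝒜.W a) _ _ _ (𝒜.piece a) _ _ (𝒜.gradedRing a)
      ((R.piece n).ideal (𝒜.W a)))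
    (R' : ReesFiltration Y) (hR' : R'.ideal = R.piece)
    [Smooth (R'.πPlus ≫ f)] [IsSeparated (R'.πPlus ≫ f)] [QuasiCompact (R'.πPlus ≫ f)]
    [IsIntegral (R'.strictTransformPlus i.ker).subscheme]
    (σX : (R'.strictTransformPlus i.ker).subscheme ⟶ X)
    (hσX : σX ≫ i = (R'.strictTransformPlus i.ker).subschemeι ≫ R'.πPlus) :
    ∃ K : V.IdealSheafData, K ≠ ⊥ ∧ ∀ (V' : Scheme.{0}) (ρ : V' ⟶ V), IsBlowup ρ K →
      ∀ [IsIntegral V'], ∃ q' : (R'.strictTransformPlus i.ker).subscheme ⟶ V',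
        q' ≫ ρ = σX ≫ q ∧
        Nonempty (GradedAtlas (j + 1) (R'.πPlus ≫ f)
          (R'.strictTransformPlus i.ker).subschemeι q') := by
  haveI : CompactSpace Y := QuasiCompact.compactSpace_of_compactSpace f
  haveI : IsLocallyNoetherian Y := LocallyOfFiniteType.isLocallyNoetherian f
  obtain ⟨N₀, hN₀, hexc⟩ :=
    Exceptional.exists_veroneseExceptional_of_isRegularWeightedCentre R hc R' hR'
  obtain ⟨Dg, hDg, hdvd, hA2, hA3⟩ :=
    Degree.qs_degree_of_isRegularWeightedCentre f i q g hq 𝒜 R hc hhom R' hR' σX hσX N₀ hN₀ hexc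
  -- `q` is quasi-compact: it is affine on the charts of the atlas (needed for `Hom.ker`)
  haveI : QuasiCompact q := by
    haveI : QuasiCompact (q ≫ g) := by rw [hq]; infer_instance
    exact .of_comp q g
  obtain ⟨hK, hlift⟩ := Lift.qs_lift_of_not_mem_support i q R hc R' hR' hξ σX hσX Dg hDg hA3
  refine ⟨_, hK, fun V' ρ hρ _ => ?_⟩
  obtain ⟨q', hq'⟩ := hlift V' ρ hρ
  exact ⟨q', hq', Atlas.gradedAtlas_succ_of_isRegularWeightedCentre f i q g hq 𝒜 R hc hξ hhom R' hR'
    σX hσX Dg hDg (hexc Dg hdvd) hA2 hA3 V' ρ hρ q' hq'⟩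

/-- **Registered form `qs_quotientStep`** of `quotientStep_of_isRegularWeightedCentre` (registered
stub of line `datum-glued-split`, RESHAPE 7, on crux stmt-0569): the quotient step of the cobordant
tower for an arbitrary regular weighted centre whose support misses the generic point of `X`.
[cite: Wlodarczyk2022, §2.3.3 and Thm 1.1.4 (5)] -/
theorem qs_quotientStep : ∀ {k : Type} [Field k] {Y X V : AlgebraicGeometry.Scheme.{0}} (f : Y ⟶ AlgebraicGeometry.Spec (.of k)) [AlgebraicGeometry.Smooth f] [AlgebraicGeometry.IsSeparated f] [AlgebraicGeometry.QuasiCompact f] (i : X ⟶ Y) [AlgebraicGeometry.IsClosedImmersion i] [AlgebraicGeometry.IsIntegral X] (q : X ⟶ V) [AlgebraicGeometry.IsIntegral V] (g : V ⟶ AlgebraicGeometry.Spec (.of k)) [AlgebraicGeometry.IsSeparated g] [AlgebraicGeometry.LocallyOfFiniteType g] [AlgebraicGeometry.QuasiCompact g], q ≫ g = i ≫ f → ∀ {j : ℕ} (𝒜 : Summit.ResolutionOfSingularities.ResolutionOfSingularities.Theorems.GradedAtlas j f i q) (R : Literature.AlgebraicGeometry.Resolution.ReesAlgebraData Y), R.IsRegularWeightedCentre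 → i (genericPoint X) ∉ R.support → (∀ (a : 𝒜.ι) (n : ℕ), @Ideal.IsHomogeneous (Fin j → ℤ) (AddSubgroup Γ(Y, 𝒜.W a)) Γ(Y, 𝒜.W a) _ _ _ (𝒜.piece a) _ _ (𝒜.gradedRing a) ((R.piece n).ideal (𝒜.W a))) → ∀ (R' : Literature.AlgebraicGeometry.Resolution.ReesFiltration Y), R'.ideal = R.piece → ∀ [AlgebraicGeometry.Smooth (R'.πPlus ≫ f)] [AlgebraicGeometry.IsSeparated (R'.πPlus ≫ f)] [AlgebraicGeometry.QuasiCompact (R'.πPlus ≫ f)] [AlgebraicGeometry.IsIntegral (R'.strictTransformPlus i.ker).subscheme] (σX : (R'.strictTransformPlus i.ker).subscheme ⟶ X), σX ≫ i = (R'.strictTransformPlus i.ker).subschemeι ≫ R'.πPlus → ∃ K : V.IdealSheafData, K ≠ ⊥ ∧ ∀ (V' : AlgebraicGeometry.Scheme.{0}) (ρ : V' ⟶ V), Literature.AlgebraicGeometry.Resolution.IsBlowup ρ K → ∀ [AlgebraicGeometry.IsIntegral V'], ∃ q' : (R'.strictTransformPlus i.ker).subscheme ⟶ V', q' ≫ ρ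 = σX ≫ q ∧ Nonempty (Summit.ResolutionOfSingularities.ResolutionOfSingularities.Theorems.GradedAtlas (j + 1) (R'.πPlus ≫ f) (R'.strictTransformPlus i.ker).subschemeι q') := by
  intro k _ Y X V f _ _ _ i _ _ q _ g _ _ _ hq j 𝒜 R hc hξ hhom R' hR' _ _ _ _ σX hσX
  exact quotientStep_of_isRegularWeightedCentre f i q g hq 𝒜 R hc hξ hhom R' hR' σX hσX

end Summit.ResolutionOfSingularities.ResolutionOfSingularities.Theorems.DatumToEmbedded

end
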